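import Literature.Analysis.FluidPDE.SverakLandauEndgame
import Literature.Analysis.FluidPDE.SverakLandauObataAlgebra
import Literature.Analysis.FluidPDE.SverakLandauObataSetup
import HarnessLib

/-!
# Šverák's classification of `(−1)`-homogeneous steady Navier–Stokes flows — `e^{−Φ/2}` is affine

Analysis/FluidPDE support file of the series `SverakLandau*` proving the named fact
`Literature.Analysis.FluidPDE.Sverak2011_landauClassification` (V. Šverák, J. Math. Sci. 179
(2011) = arXiv:math/0604550, Thm. 1).

Šverák, §4, (E4)–(E6): the solutions of `−Δφ + 2 = 2e^φ` on `S²` are, in a suitable frame,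
`φ = −2 log(cosh κ − sinh κ cos θ)`, i.e. `e^{−φ/2}` is the restriction of an affine function
`α + ⟪β, y⟫` with `α² − |β|² = 1` (in print: by the conformal geometry of `S²`, [CY], [DFN]).  Here,
in the `ℝ³ ∖ {0}` rendering and by the Obata-type identity of `SverakLandauObataAlgebra`:

* `Sverak2011.obata_tracefree_hessian_eq_zero` — for `Ψ = e^{−Φ/2}` (the potential of
  `exists_conformal_potential`) the tensor `B̃ = r²∇²Ψ + ∇Ψ xᵀ + x ∇Ψᵀ − ½r²ΔΨ(I − xxᵀ/r²)`
  vanishes on `{x ≠ 0}` (integrate `div(Ψ⁻¹B̃∇Ψ) = Ψ⁻¹|B̃|²/r²` against radial bumps);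
* `Sverak2011.exists_affine_conformalFactor` — **`e^{−Φ(x)/2} = α + ⟪β, x⟫/|x|` with
  `α² = 1 + |β|²`, `α > 0`** (`½r²ΔΨ + Ψ ≡ α` since its gradient is `div B̃ = 0`;
  `|x|∇Ψ + (Ψ − α)x/|x| ≡ β` since its derivative is `|x|⁻¹B̃ = 0`; the relation between `α` and
  `β` from the equation at one point; `α > 0` from `Ψ > 0`).

## References

* V. Šverák, *On Landau's solutions of the Navier–Stokes equations*, J. Math. Sci. 179 (2011)
  208–228, arXiv:math/0604550, §4, (E4)–(E6). [`Sverak2011`]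
* M. Obata, J. Math. Soc. Japan 14 (1962) 333–340. [folklore]
-/

noncomputable section

open Set Filter Metric MeasureTheory
open scoped Topology BigOperators ContDiff Laplacian RealInnerProductSpace

namespace Literature.Analysis.FluidPDE

namespace Sverak2011

/-! ### Derivatives of `|x|` and `|x|⁻¹` in coordinates -/

/-- `D|·|(x) = |x|⁻¹⟪x, ·⟫` at `x ≠ 0`. [folklore] -/
theorem hasFDerivAt_norm_of_ne_zero {x : EuclideanSpace ℝ (Fin 3)} (hx : x ≠ 0) :
    HasFDerivAt (fun w : EuclideanSpace ℝ (Fin 3) => ‖w‖)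
      (‖x‖⁻¹ • (innerSL ℝ x : EuclideanSpace ℝ (Fin 3) →L[ℝ] ℝ)) x := by
  have hr : 0 < ‖x‖ := norm_pos_iff.mpr hx
  have h1 : HasDerivAt Real.sqrt (1 / (2 * Real.sqrt (‖x‖ ^ 2))) (‖x‖ ^ 2) :=
    Real.hasDerivAt_sqrt (pow_pos hr 2).ne'
  have h3 := hasFDerivAt_comp_norm_sq h1
  have hfun : (fun w : EuclideanSpace ℝ (Fin 3) => Real.sqrt (‖w‖ ^ 2)) = fun w => ‖w‖ := by
    funext w; rw [Real.sqrt_sq (norm_nonneg w)]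
  rw [hfun, Real.sqrt_sq hr.le] at h3
  have e : (2 : ℝ) * (1 / (2 * ‖x‖)) = ‖x‖⁻¹ := by field_simp
  rw [e] at h3
  exact h3

/-- Partials of smooth `N`, `W` which agree with `|·|`, `|·|⁻¹` on the open set `{δ < |y|}`
(`δ > 0`): `∂ⱼN = yⱼW`, `∂ⱼW = −yⱼW³` there. [folklore] -/
theorem pderiv_norm_reg {N W : EuclideanSpace ℝ (Fin 3) → ℝ} {δ : ℝ} (hδ : 0 < δ)
    (hN : ∀ y, δ ≤ ‖y‖ → N y = ‖y‖) (hW : ∀ y, δ ≤ ‖y‖ → W y = ‖y‖⁻¹)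
    {y : EuclideanSpace ℝ (Fin 3)} (hy : δ < ‖y‖) (j : Fin 3) :
    pderiv j N y = y j * W y ∧ pderiv j W y = -y j * W y ^ 3 := by
  have hy0 := ne_zero_of_lt_norm hδ hy
  have hNev : N =ᶠ[𝓝 y] fun w => ‖w‖ := eventuallyEq_of_eq_of_le_norm hN hy
  have hWev : W =ᶠ[𝓝 y] fun w => ‖w‖⁻¹ := eventuallyEq_of_eq_of_le_norm hW hy
  have hi : ⟪y, (EuclideanSpace.single j 1 : EuclideanSpace ℝ (Fin 3))⟫ = y j := by
    rw [EuclideanSpace.inner_single_right]; simp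
  constructor
  · rw [pderiv_apply, hNev.fderiv_eq, (hasFDerivAt_norm_of_ne_zero hy0).fderiv, hW y hy.le]
    simp only [FunLike.coe_smul, Pi.smul_apply, innerSL_real_coe_apply_apply, smul_eq_mul, stdVec, hi]
    ring
  · rw [pderiv_apply, hWev.fderiv_eq, (hasFDerivAt_inv_norm hy0).fderiv, hW y hy.le]
    simp only [FunLike.coe_smul, Pi.smul_apply, innerSL_real_coe_apply_apply, smul_eq_mul, stdVec, hi]
    ring

/-! ### A vector field vanishes where all its components have zero derivative -/

/-- If every component of `f : ℝ³ → ℝ³` has all partial derivatives zero at `x` (and `f` is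
differentiable at `x`), then `Df(x) = 0`. [folklore] -/
theorem fderiv_eq_zero_of_pderiv_comp_eq_zero {f : EuclideanSpace ℝ (Fin 3) → EuclideanSpace ℝ (Fin 3)}
    {x : EuclideanSpace ℝ (Fin 3)} (hf : DifferentiableAt ℝ f x)
    (h : ∀ i j, pderiv j (fun y => f y i) x = 0) : fderiv ℝ f x = 0 := by
  ext w i
  rw [euclidean_fderiv_apply_comp hf, fderiv_apply_eq_sum_mul_pderiv]
  simp [h i]

/-- If every partial derivative of `f : ℝ³ → ℝ` vanishes at `x` then `Df(x) = 0`. [folklore] -/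
theorem fderiv_eq_zero_of_pderiv_eq_zero {f : EuclideanSpace ℝ (Fin 3) → ℝ}
    {x : EuclideanSpace ℝ (Fin 3)} (h : ∀ j, pderiv j f x = 0) : fderiv ℝ f x = 0 := by
  ext w
  rw [fderiv_apply_eq_sum_mul_pderiv]
  simp [h]

/-! ### The main steps -/

variable {u : EuclideanSpace ℝ (Fin 3) → EuclideanSpace ℝ (Fin 3)} {p : EuclideanSpace ℝ (Fin 3) → ℝ}

/-- **`B̃ ≡ 0`** (Obata step).  For the data of Theorem 1 and a potential `Φ` as in
`exists_conformal_potential`, `Ψ = e^{−Φ/2}` satisfies at every `x ≠ 0`, for all `l m`: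
`r²∂ₗ∂ₘΨ + ∂ₗΨ xₘ + xₗ∂ₘΨ − ½r²ΔΨ δₗₘ + ½ΔΨ xₗxₘ = 0`, together with Euler's relation
`∑ⱼ xⱼ∂ⱼΨ = 0` and the Liouville equation `r²(ΨΔΨ − |∇Ψ|²) + Ψ² = 1` (all partials of the
global function `Ψ = fun x ↦ e^{−Φ(x)/2}`). [cite: Sverak2011, §4 (E4)–(E6)] -/
theorem obata_tracefree_hessian_eq_zero (hu : ContDiffOn ℝ ∞ u {x | x ≠ 0})
    (hp : ContDiffOn ℝ ∞ p {x | x ≠ 0})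
    (hns : ∀ x, x ≠ 0 → -(Δ u) x + convect u u x + gradient p x = 0)
    (hdiv : ∀ x, x ≠ 0 → VectorCalculus.divergence u x = 0)
    (hhom : ∀ (t : ℝ) (x : EuclideanSpace ℝ (Fin 3)), 0 < t → x ≠ 0 → t • u (t • x) = u x)
    {Φ : EuclideanSpace ℝ (Fin 3) → ℝ} (hΦs : ContDiffOn ℝ ∞ Φ {x | x ≠ 0})
    (hΦ : ∀ x : EuclideanSpace ℝ (Fin 3), x ≠ 0 →
      HasFDerivAt Φ (innerSL ℝ (u x - (⟪x, u x⟫ / ‖x‖ ^ 2) • x)) x)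
    (hΦF : ∀ x : EuclideanSpace ℝ (Fin 3), x ≠ 0 → 2 + ⟪x, u x⟫ = 2 * Real.exp (Φ x))
    {Ψ : EuclideanSpace ℝ (Fin 3) → ℝ} (hΨ : Ψ = fun x => Real.exp (-(Φ x) / 2))
    {x : EuclideanSpace ℝ (Fin 3)} (hx : x ≠ 0) :
    (∀ l m, (∑ i, x i ^ 2) * pderiv l (pderiv m Ψ) x + pderiv l Ψ x * x m + x l * pderiv m Ψ x -
      (∑ i, x i ^ 2) * (∑ k, pderiv k (pderiv k Ψ) x) / 2 * (if l = m then 1 else 0) +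
      (∑ k, pderiv k (pderiv k Ψ) x) / 2 * (x l * x m) = 0) ∧
    (∑ j, x j * pderiv j Ψ x = 0) ∧
    ((∑ i, x i ^ 2) * (Ψ x * ∑ l, pderiv l (pderiv l Ψ) x - ∑ l, pderiv l Ψ x ^ 2) + Ψ x ^ 2 = 1) ∧
    (∀ m, ∑ j, x j * pderiv j (pderiv m Ψ) x = -pderiv m Ψ x) ∧ ContDiffAt ℝ ∞ Ψ x := by
  have hc : 0 < ‖x‖ := norm_pos_iff.mpr hx
  obtain ⟨Ψr, hΨc, hΨ0, hΨpos, hΨΨ, hE0, hE1, hE2, hPDE, hPDE'⟩ :=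
    obata_setup hu hp hns hdiv hhom hΦs hΦ hΦF hc
  have hδ : 0 < ‖x‖ / 4 := by positivity
  have hS := isOpen_lt_norm (‖x‖ / 4)
  have hxS : x ∈ {y : EuclideanSpace ℝ (Fin 3) | ‖x‖ / 4 < ‖y‖} := by
    show ‖x‖ / 4 < ‖x‖; linarith
  have hEq : EqOn Ψ Ψr {y | ‖x‖ / 4 < ‖y‖} := fun y hy => by rw [hΨ, hΨΨ y (le_of_lt hy)]
  -- symbols as functions of `y`
  set g : Fin 3 → EuclideanSpace ℝ (Fin 3) → ℝ := fun m => pderiv m Ψr with hgdef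
  set H : Fin 3 → Fin 3 → EuclideanSpace ℝ (Fin 3) → ℝ := fun j m => pderiv j (pderiv m Ψr)
    with hHdef
  set T : Fin 3 → Fin 3 → Fin 3 → EuclideanSpace ℝ (Fin 3) → ℝ :=
    fun a b c => pderiv a (pderiv b (pderiv c Ψr)) with hTdef
  set r2 : EuclideanSpace ℝ (Fin 3) → ℝ := fun y => ∑ i, y i ^ 2 with hr2def
  set Lf : EuclideanSpace ℝ (Fin 3) → ℝ := fun y => ∑ l, H l l y with hLdef
  set Gf : EuclideanSpace ℝ (Fin 3) → ℝ := fun y => ∑ l, g l y ^ 2 with hGdef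
  set Lj : Fin 3 → EuclideanSpace ℝ (Fin 3) → ℝ := fun j => pderiv j Lf with hLjdef
  set br : Fin 3 → EuclideanSpace ℝ (Fin 3) → ℝ := fun j y =>
    r2 y * ∑ m, H j m y * g m y + Gf y * y j - r2 y * Lf y / 2 * g j y with hbrdef
  set B : Fin 3 → Fin 3 → EuclideanSpace ℝ (Fin 3) → ℝ := fun l m y =>
    r2 y * H l m y + g l y * y m + y l * g m y - r2 y * Lf y / 2 * (if l = m then 1 else 0) +
      Lf y / 2 * (y l * y m) with hBdef
  have hTsym : ∀ j m y, T j j m y = T m j j y := by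
    intro j m y
    simp only [hTdef]
    rw [pderiv_comm hΨc j m, pderiv_comm (contDiff_pderiv hΨc j) j m]
  have hHsym : ∀ a b y, H a b y = H b a y := fun a b y => by
    simp only [hHdef]; rw [pderiv_comm hΨc a b]
  -- smoothness
  have hgc : ∀ m, ContDiff ℝ ∞ (g m) := fun m => contDiff_pderiv hΨc m
  have hHc : ∀ a b, ContDiff ℝ ∞ (H a b) := fun a b => contDiff_pderiv₂ hΨc a b
  have hr2c : ContDiff ℝ ∞ r2 := ContDiff.sum fun i _ => (contDiff_coord i).pow 2
  have hLc : ContDiff ℝ ∞ Lf := ContDiff.sum fun l _ => hHc l l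
  have hGc : ContDiff ℝ ∞ Gf := ContDiff.sum fun l _ => (hgc l).pow 2
  have hbrc : ∀ j, ContDiff ℝ ∞ (br j) := fun j =>
    ((hr2c.mul (ContDiff.sum fun m _ => (hHc j m).mul (hgc m))).add (hGc.mul (contDiff_coord j))).sub
      (((hr2c.mul hLc).div_const 2).mul (hgc j))
  have hinvc : ContDiff ℝ ∞ fun y => (Ψr y)⁻¹ := hΨc.inv hΨ0
  -- the vector field `Z = Ψ⁻¹ B̃ g` and its properties on the shell
  set Zv : EuclideanSpace ℝ (Fin 3) → EuclideanSpace ℝ (Fin 3) :=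
    fun y => WithLp.toLp 2 fun j => (Ψr y)⁻¹ * br j y with hZv
  have hZi : ∀ j, (fun y => Zv y j) = fun y => (Ψr y)⁻¹ * br j y := fun j => by
    funext y; simp [hZv]
  have hZc : ContDiff ℝ ∞ Zv := by
    rw [contDiff_euclidean]; intro j; rw [hZi]; exact hinvc.mul (hbrc j)
  have hrel : ∀ y ∈ {y : EuclideanSpace ℝ (Fin 3) | ‖x‖ / 4 < ‖y‖},
      (∑ j, y j * br j y = 0) ∧
      (∑ j, (-(g j y * br j y) + Ψr y * pderiv j (br j) y) =
        Ψr y * (r2 y * ∑ l, ∑ m, H l m y ^ 2 - 2 * Gf y - r2 y * Lf y ^ 2 / 2)) ∧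
      (∑ l, ∑ m, B l m y ^ 2 = r2 y ^ 2 * ∑ l, ∑ m, H l m y ^ 2 - 2 * r2 y * Gf y -
        r2 y ^ 2 * Lf y ^ 2 / 2) := by
    intro y hy
    have e0 := hE0 y hy
    have e1 := hE1 y hy
    have e2 := hE2 y hy
    refine ⟨?_, ?_, ?_⟩
    · exact obata_tangential_algebra (fun i => y i) (fun m => g m y) (fun j => br j y)
        (fun a b => H a b y) (r2 y) (Lf y) (Gf y) rfl rfl (fun j => rfl) e0 e1
    · refine obata_div_algebra (fun i => y i) (fun m => g m y) (fun j => Lj j y) (fun j => br j y)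
        (fun j => pderiv j (br j) y) (fun a b => H a b y) (fun a b c => T a b c y) (Ψr y) (r2 y)
        (Lf y) (Gf y) rfl rfl rfl (fun j => ?_) (fun j => rfl) (fun j => ?_) e0 e1
        (fun j m => hTsym j m y) (fun j => ?_)
      · rw [hLjdef]; exact congrFun (pderiv_obataL hΨc (fun _ _ => rfl) (fun _ _ _ => rfl) rfl j) y
      · exact congrFun (pderiv_obataBr hΨc (fun _ => rfl) (fun _ _ => rfl) (fun _ _ _ => rfl)
          rfl rfl rfl (fun _ => rfl) (fun _ => rfl) j) y
      · have := hPDE' y hy j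
        have hLj : Lj j y = ∑ l, T j l l y := by
          rw [hLjdef]; exact congrFun (pderiv_obataL hΨc (fun _ _ => rfl) (fun _ _ _ => rfl) rfl j) y
        rw [hLj]
        simp only [hgdef, hHdef, hTdef, hr2def, hLdef, hGdef] at this ⊢
        linarith
    · exact obata_normSq_algebra (fun i => y i) (fun m => g m y) (fun a b => H a b y)
        (fun a b => B a b y) (r2 y) (Lf y) (Gf y) rfl rfl rfl (fun l m => rfl) e0 e1
        (fun a b => hHsym a b y)
  have hdivZ : ∀ y ∈ {y : EuclideanSpace ℝ (Fin 3) | ‖x‖ / 4 < ‖y‖},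
      VectorCalculus.divergence Zv y = (Ψr y)⁻¹ * (∑ l, ∑ m, B l m y ^ 2) / r2 y := by
    intro y hy
    obtain ⟨-, h2, h3⟩ := hrel y hy
    have hr0 : r2 y ≠ 0 := by
      rw [hr2def]; show (∑ i, y i ^ 2) ≠ 0
      rw [← EuclideanSpace.real_norm_sq_eq]
      exact pow_ne_zero 2 (norm_ne_zero_iff.mpr (ne_zero_of_lt_norm hδ hy))
    rw [divergence_eq_sum_pderiv ((hZc.differentiable (by simp)) y)]
    simp only [hZi]
    rw [Finset.sum_congr rfl fun j _ => pderiv_obataZ hΨc hΨ0 (fun _ => rfl) j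
      ((hbrc j).differentiable (by simp)) y]
    have : ∑ j, (-(Ψr y ^ 2)⁻¹ * g j y * br j y + (Ψr y)⁻¹ * pderiv j (br j) y) =
        (Ψr y ^ 2)⁻¹ * ∑ j, (-(g j y * br j y) + Ψr y * pderiv j (br j) y) := by
      rw [Finset.mul_sum]
      refine Finset.sum_congr rfl fun j _ => ?_
      have := hΨ0 y
      field_simp
    rw [this, h2, h3]
    have := hΨ0 y
    field_simp
  -- integrate against the bump at radius `|x|`
  set χ : ContDiffBump (‖x‖ : ℝ) := ⟨‖x‖ / 4, ‖x‖ / 2, by positivity, by linarith⟩ with hχdef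
  have hχ : χ.rOut < ‖x‖ := by show ‖x‖ / 2 < ‖x‖; linarith
  have hmem : ∀ z : EuclideanSpace ℝ (Fin 3), ‖z‖ ∈ tsupport χ →
      z ∈ {y : EuclideanSpace ℝ (Fin 3) | ‖x‖ / 4 < ‖y‖} := by
    intro z hz
    rw [χ.tsupport_eq, mem_closedBall, Real.dist_eq] at hz
    have := abs_sub_le_iff.mp hz
    show ‖x‖ / 4 < ‖z‖
    have h2 : ‖x‖ - ‖z‖ ≤ ‖x‖ / 2 := this.2
    linarith
  have hχ0 : ∀ z : EuclideanSpace ℝ (Fin 3), z ∉ {y : EuclideanSpace ℝ (Fin 3) | ‖x‖ / 4 < ‖y‖} →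
      χ ‖z‖ = 0 := by
    intro z hz
    apply χ.zero_of_le_dist
    simp only [mem_setOf_eq, not_lt] at hz
    rw [Real.dist_eq]
    show ‖x‖ / 2 ≤ |‖z‖ - ‖x‖|
    rw [abs_of_nonpos (by linarith)]; linarith
  have I : ∫ z, χ ‖z‖ * VectorCalculus.divergence Zv z = 0 :=
    integral_bump_mul_divergence_eq_zero χ hχ (hZc.of_le (by norm_cast)) fun z hz => by
      obtain ⟨h1, -, -⟩ := hrel z (hmem z hz)
      have : ⟪z, Zv z⟫ = (Ψr z)⁻¹ * ∑ j, z j * br j z := by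
        simp only [hZv, PiLp.inner_apply, RCLike.inner_apply, conj_trivial]
        rw [Finset.mul_sum]
        exact Finset.sum_congr rfl fun j _ => by ring
      rw [this, h1, mul_zero]
  set Q : EuclideanSpace ℝ (Fin 3) → ℝ := fun y => ∑ l, ∑ m, B l m y ^ 2 with hQ
  have heq : (fun z => χ ‖z‖ * VectorCalculus.divergence Zv z) =
      fun z => χ ‖z‖ * ((Ψr z)⁻¹ * Q z / r2 z) := by
    funext z
    by_cases hz : z ∈ {y : EuclideanSpace ℝ (Fin 3) | ‖x‖ / 4 < ‖y‖}
    · rw [hdivZ z hz]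
    · rw [hχ0 z hz, zero_mul, zero_mul]
  rw [heq] at I
  have hBc : ∀ l m, ContDiff ℝ ∞ (B l m) := fun l m =>
    ((((hr2c.mul (hHc l m)).add ((hgc l).mul (contDiff_coord m))).add
      ((contDiff_coord l).mul (hgc m))).sub (((hr2c.mul hLc).div_const 2).mul contDiff_const)).add
      ((hLc.div_const 2).mul ((contDiff_coord l).mul (contDiff_coord m)))
  have hQc : ContDiff ℝ ∞ Q := ContDiff.sum fun l _ => ContDiff.sum fun m _ => (hBc l m).pow 2
  have hcs := hasCompactSupport_bump_norm χ
  have hχc : Continuous fun z : EuclideanSpace ℝ (Fin 3) => χ ‖z‖ := χ.continuous.comp continuous_norm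
  -- on the shell `r2 = |z|²` and everything is smooth; off the shell `χ = 0`
  have hcont : Continuous fun z => χ ‖z‖ * ((Ψr z)⁻¹ * Q z / r2 z) := by
    have h1 : (fun z => χ ‖z‖ * ((Ψr z)⁻¹ * Q z / r2 z)) =
        fun z => χ ‖z‖ * ((Ψr z)⁻¹ * Q z * (fun z => (r2 z)⁻¹) z) := by
      funext z; simp only [div_eq_mul_inv]
    rw [h1]
    obtain ⟨Rg, hRg, hRgr⟩ := exists_contDiff_eq_of_contDiffOn (n := ⊤)
      (f := fun z : EuclideanSpace ℝ (Fin 3) => (r2 z)⁻¹) (by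
        refine hr2c.contDiffOn.inv fun z hz => ?_
        rw [hr2def]; show (∑ i, z i ^ 2) ≠ 0
        rw [← EuclideanSpace.real_norm_sq_eq]; exact pow_ne_zero 2 (norm_ne_zero_iff.mpr hz)) hδ
    have h2 : (fun z => χ ‖z‖ * ((Ψr z)⁻¹ * Q z * (fun z => (r2 z)⁻¹) z)) =
        fun z => χ ‖z‖ * ((Ψr z)⁻¹ * Q z * Rg z) := by
      funext z
      by_cases hz : z ∈ {y : EuclideanSpace ℝ (Fin 3) | ‖x‖ / 4 < ‖y‖}
      · rw [hRgr z (le_of_lt hz)]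
      · rw [hχ0 z hz, zero_mul, zero_mul]
    rw [h2]
    exact hχc.mul ((hinvc.continuous.mul hQc.continuous).mul hRg.continuous)
  have hnn : ∀ z, 0 ≤ χ ‖z‖ * ((Ψr z)⁻¹ * Q z / r2 z) := by
    intro z
    refine mul_nonneg χ.nonneg (div_nonneg (mul_nonneg (inv_pos.mpr (hΨpos z)).le ?_) ?_)
    · exact Finset.sum_nonneg fun l _ => Finset.sum_nonneg fun m _ => sq_nonneg _
    · exact Finset.sum_nonneg fun i _ => sq_nonneg _
  have hQx : Q x = 0 := by
    by_contra hne
    have hval : χ ‖x‖ * ((Ψr x)⁻¹ * Q x / r2 x) ≠ 0 := by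
      have h1 : χ ‖x‖ = 1 := χ.one_of_mem_closedBall (mem_closedBall_self χ.rIn_pos.le)
      have h2 : r2 x ≠ 0 := by
        rw [hr2def]; show (∑ i, x i ^ 2) ≠ 0
        rw [← EuclideanSpace.real_norm_sq_eq]; exact pow_ne_zero 2 hc.ne'
      rw [h1, one_mul]
      exact div_ne_zero (mul_ne_zero (inv_ne_zero (hΨ0 x)) hne) h2
    have := hcont.integral_pos_of_hasCompactSupport_nonneg_nonzero
      (μ := (volume : Measure (EuclideanSpace ℝ (Fin 3)))) hcs.mul_right hnn hval
    linarith
  -- conclude at `x`, transferring the partials of `Ψr` to those of `Ψ`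
  have hBx : ∀ l m, B l m x = 0 := by
    intro l m
    have h1 : ∑ l, ∑ m, B l m x ^ 2 = 0 := hQx
    have h2 := (Finset.sum_eq_zero_iff_of_nonneg fun l _ =>
      Finset.sum_nonneg fun m _ => sq_nonneg (B l m x)).mp h1 l (Finset.mem_univ l)
    have h3 := (Finset.sum_eq_zero_iff_of_nonneg fun m _ => sq_nonneg (B l m x)).mp h2 m
      (Finset.mem_univ m)
    exact pow_eq_zero_iff (n := 2) (by norm_num) |>.mp h3
  have hp1 : ∀ j, pderiv j Ψ x = pderiv j Ψr x := fun j => pderiv_eqOn hS hEq j hxS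
  have hp2 : ∀ j m, pderiv j (pderiv m Ψ) x = pderiv j (pderiv m Ψr) x := fun j m =>
    pderiv_pderiv_eqOn hS hEq j m hxS
  refine ⟨fun l m => ?_, ?_, ?_, fun m => ?_, ?_⟩
  · have := hBx l m
    simp only [hBdef, hHdef, hgdef, hr2def, hLdef] at this
    simp only [hp1, hp2]
    linarith [this]
  · simp only [hp1]; exact hE0 x hxS
  · simp only [hp1, hp2, hEq hxS]; exact hPDE x hxS
  · simp only [hp1, hp2]; exact hE1 x hxS m
  · exact hΨc.contDiffAt.congr_of_eventuallyEq (hEq.eventuallyEq_of_mem (hS.mem_nhds hxS))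

/-- **`λ = ½r²ΔΨ + Ψ` has zero derivative** on `{x ≠ 0}` (its gradient is `div B̃ = 0`).
[cite: Sverak2011, §4 (E4)–(E6)] -/
theorem obata_lambda_fderiv_eq_zero (hu : ContDiffOn ℝ ∞ u {x | x ≠ 0})
    (hp : ContDiffOn ℝ ∞ p {x | x ≠ 0})
    (hns : ∀ x, x ≠ 0 → -(Δ u) x + convect u u x + gradient p x = 0)
    (hdiv : ∀ x, x ≠ 0 → VectorCalculus.divergence u x = 0)
    (hhom : ∀ (t : ℝ) (x : EuclideanSpace ℝ (Fin 3)), 0 < t → x ≠ 0 → t • u (t • x) = u x)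
    {Φ : EuclideanSpace ℝ (Fin 3) → ℝ} (hΦs : ContDiffOn ℝ ∞ Φ {x | x ≠ 0})
    (hΦ : ∀ x : EuclideanSpace ℝ (Fin 3), x ≠ 0 →
      HasFDerivAt Φ (innerSL ℝ (u x - (⟪x, u x⟫ / ‖x‖ ^ 2) • x)) x)
    (hΦF : ∀ x : EuclideanSpace ℝ (Fin 3), x ≠ 0 → 2 + ⟪x, u x⟫ = 2 * Real.exp (Φ x))
    {Ψ : EuclideanSpace ℝ (Fin 3) → ℝ} (hΨ : Ψ = fun x => Real.exp (-(Φ x) / 2))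
    {x : EuclideanSpace ℝ (Fin 3)} (hx : x ≠ 0) :
    DifferentiableAt ℝ (fun y : EuclideanSpace ℝ (Fin 3) =>
      (∑ i, y i ^ 2) * (∑ l, pderiv l (pderiv l Ψ) y) / 2 + Ψ y) x ∧
    fderiv ℝ (fun y : EuclideanSpace ℝ (Fin 3) =>
      (∑ i, y i ^ 2) * (∑ l, pderiv l (pderiv l Ψ) y) / 2 + Ψ y) x = 0 := by
  have hc : 0 < ‖x‖ := norm_pos_iff.mpr hx
  obtain ⟨Ψr, hΨc, hΨ0, -, hΨΨ, -, hE1, hE2, -, -⟩ :=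
    obata_setup hu hp hns hdiv hhom hΦs hΦ hΦF hc
  have hδ : 0 < ‖x‖ / 4 := by positivity
  have hS := isOpen_lt_norm (‖x‖ / 4)
  have hxS : x ∈ {y : EuclideanSpace ℝ (Fin 3) | ‖x‖ / 4 < ‖y‖} := by
    show ‖x‖ / 4 < ‖x‖; linarith
  have hEq : EqOn Ψ Ψr {y | ‖x‖ / 4 < ‖y‖} := fun y hy => by rw [hΨ, hΨΨ y (le_of_lt hy)]
  set H : Fin 3 → Fin 3 → EuclideanSpace ℝ (Fin 3) → ℝ := fun j m => pderiv j (pderiv m Ψr)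
    with hHdef
  set T : Fin 3 → Fin 3 → Fin 3 → EuclideanSpace ℝ (Fin 3) → ℝ :=
    fun a b c => pderiv a (pderiv b (pderiv c Ψr)) with hTdef
  set r2 : EuclideanSpace ℝ (Fin 3) → ℝ := fun y => ∑ i, y i ^ 2 with hr2def
  set Lf : EuclideanSpace ℝ (Fin 3) → ℝ := fun y => ∑ l, H l l y with hLdef
  set Lj : Fin 3 → EuclideanSpace ℝ (Fin 3) → ℝ := fun j => pderiv j Lf with hLjdef
  set B : Fin 3 → Fin 3 → EuclideanSpace ℝ (Fin 3) → ℝ := fun l m y =>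
    r2 y * H l m y + pderiv l Ψr y * y m + y l * pderiv m Ψr y -
      r2 y * Lf y / 2 * (if l = m then 1 else 0) + Lf y / 2 * (y l * y m) with hBdef
  have hHc : ∀ a b, ContDiff ℝ ∞ (H a b) := fun a b => contDiff_pderiv₂ hΨc a b
  have hr2c : ContDiff ℝ ∞ r2 := ContDiff.sum fun i _ => (contDiff_coord i).pow 2
  have hLc : ContDiff ℝ ∞ Lf := ContDiff.sum fun l _ => hHc l l
  -- the regularised `λ` agrees with the true one on the shell and is smooth
  set lamr : EuclideanSpace ℝ (Fin 3) → ℝ := fun y => r2 y * Lf y / 2 + Ψr y with hlamr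
  have hlamc : ContDiff ℝ ∞ lamr := ((hr2c.mul hLc).div_const 2).add hΨc
  have hEqlam : (fun y : EuclideanSpace ℝ (Fin 3) =>
      (∑ i, y i ^ 2) * (∑ l, pderiv l (pderiv l Ψ) y) / 2 + Ψ y) =ᶠ[𝓝 x] lamr := by
    filter_upwards [hS.mem_nhds hxS] with y hy
    simp only [hlamr, hr2def, hLdef, hHdef, pderiv_pderiv_eqOn hS hEq _ _ hy, hEq hy]
  -- `B̃` vanishes on the shell, hence so do its partials at `x`
  have hB0 : ∀ j m, ∀ y ∈ {y : EuclideanSpace ℝ (Fin 3) | ‖x‖ / 4 < ‖y‖}, B j m y = 0 := by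
    intro j m y hy
    have hy0 := ne_zero_of_lt_norm hδ hy
    have h := (obata_tracefree_hessian_eq_zero hu hp hns hdiv hhom hΦs hΦ hΦF hΨ hy0).1 j m
    simp only [pderiv_pderiv_eqOn hS hEq _ _ hy, pderiv_eqOn hS hEq _ hy] at h
    simp only [hBdef, hr2def, hLdef, hHdef]
    linarith [h]
  have hdB0 : ∀ j m, pderiv j (B j m) x = 0 := fun j m =>
    pderiv_eq_zero_of_eqOn_zero hS (hB0 j m) j hxS
  have hTsym : ∀ j m, T j j m x = T m j j x := by
    intro j m
    simp only [hTdef]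
    rw [pderiv_comm hΨc j m, pderiv_comm (contDiff_pderiv hΨc j) j m]
  have hLj : ∀ j, Lj j x = ∑ l, T j l l x := fun j =>
    congrFun (pderiv_obataL hΨc (fun _ _ => rfl) (fun _ _ _ => rfl) rfl j) x
  -- all partials of `lamr` vanish at `x`
  have hpl : ∀ m, pderiv m lamr x = 0 := by
    intro m
    have h1 := pderiv_obataLam (g := fun m => pderiv m Ψr) (H := H) (r2 := r2) (Lf := Lf) (Lj := Lj)
      hΨc (fun _ => rfl) (fun _ _ => rfl) rfl rfl (fun _ => rfl) m x
    have h2 := fun m' => sum_pderiv_obataB (g := fun m => pderiv m Ψr) (H := H) (T := T) (r2 := r2)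
      (Lf := Lf) (Lj := Lj) (B := B) hΨc (fun _ => rfl) (fun _ _ => rfl) (fun _ _ _ => rfl) rfl rfl
      (fun _ => rfl) (fun l m => rfl) m' x
    have h3 := obata_divB_algebra (fun i => x i) (fun m => pderiv m Ψr x) (fun j => Lj j x)
      (fun m => ∑ j, pderiv j (B j m) x) (fun a b => H a b x) (fun a b c => T a b c x) (r2 x)
      (Lf x) rfl rfl hLj h2 (hE1 x hxS) (hE2 x hxS) hTsym m
    have h4 : ∑ j, pderiv j (B j m) x = 0 := Finset.sum_eq_zero fun j _ => hdB0 j m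
    rw [show pderiv m lamr x = pderiv m (fun y => r2 y * Lf y / 2 + Ψr y) x from rfl, h1]
    linarith [h3, h4]
  have hfl : fderiv ℝ lamr x = 0 := fderiv_eq_zero_of_pderiv_eq_zero hpl
  refine ⟨(hlamc.contDiffAt.differentiableAt (by simp)).congr_of_eventuallyEq hEqlam, ?_⟩
  rw [hEqlam.fderiv_eq, hfl]

/-- **`b = |x|∇Ψ + (Ψ − α)x/|x|` has zero derivative** on `{x ≠ 0}` once `½r²ΔΨ + Ψ ≡ α`
(its derivative is `|x|⁻¹B̃ = 0`). [cite: Sverak2011, §4 (E4)–(E6)] -/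
theorem obata_bvec_fderiv_eq_zero (hu : ContDiffOn ℝ ∞ u {x | x ≠ 0})
    (hp : ContDiffOn ℝ ∞ p {x | x ≠ 0})
    (hns : ∀ x, x ≠ 0 → -(Δ u) x + convect u u x + gradient p x = 0)
    (hdiv : ∀ x, x ≠ 0 → VectorCalculus.divergence u x = 0)
    (hhom : ∀ (t : ℝ) (x : EuclideanSpace ℝ (Fin 3)), 0 < t → x ≠ 0 → t • u (t • x) = u x)
    {Φ : EuclideanSpace ℝ (Fin 3) → ℝ} (hΦs : ContDiffOn ℝ ∞ Φ {x | x ≠ 0})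
    (hΦ : ∀ x : EuclideanSpace ℝ (Fin 3), x ≠ 0 →
      HasFDerivAt Φ (innerSL ℝ (u x - (⟪x, u x⟫ / ‖x‖ ^ 2) • x)) x)
    (hΦF : ∀ x : EuclideanSpace ℝ (Fin 3), x ≠ 0 → 2 + ⟪x, u x⟫ = 2 * Real.exp (Φ x))
    {Ψ : EuclideanSpace ℝ (Fin 3) → ℝ} (hΨ : Ψ = fun x => Real.exp (-(Φ x) / 2)) {α : ℝ}
    (hα : ∀ y : EuclideanSpace ℝ (Fin 3), y ≠ 0 →
      (∑ i, y i ^ 2) * (∑ l, pderiv l (pderiv l Ψ) y) / 2 + Ψ y = α)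
    {x : EuclideanSpace ℝ (Fin 3)} (hx : x ≠ 0) :
    DifferentiableAt ℝ (fun y : EuclideanSpace ℝ (Fin 3) => WithLp.toLp 2 fun m =>
      ‖y‖ * pderiv m Ψ y + (Ψ y - α) * y m * ‖y‖⁻¹ : EuclideanSpace ℝ (Fin 3) → EuclideanSpace ℝ (Fin 3)) x ∧
    fderiv ℝ (fun y : EuclideanSpace ℝ (Fin 3) => WithLp.toLp 2 fun m =>
      ‖y‖ * pderiv m Ψ y + (Ψ y - α) * y m * ‖y‖⁻¹ : EuclideanSpace ℝ (Fin 3) → EuclideanSpace ℝ (Fin 3)) x = 0 := by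
  have hc : 0 < ‖x‖ := norm_pos_iff.mpr hx
  have hΩ : IsOpen {y : EuclideanSpace ℝ (Fin 3) | y ≠ 0} := isOpen_compl_singleton
  obtain ⟨Ψr, hΨc, hΨ0, -, hΨΨ, -, -, -, -, -⟩ :=
    obata_setup hu hp hns hdiv hhom hΦs hΦ hΦF hc
  have hδ : 0 < ‖x‖ / 4 := by positivity
  have hS := isOpen_lt_norm (‖x‖ / 4)
  have hxS : x ∈ {y : EuclideanSpace ℝ (Fin 3) | ‖x‖ / 4 < ‖y‖} := by
    show ‖x‖ / 4 < ‖x‖; linarith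
  have hEq : EqOn Ψ Ψr {y | ‖x‖ / 4 < ‖y‖} := fun y hy => by rw [hΨ, hΨΨ y (le_of_lt hy)]
  -- regularised `|x|`, `|x|⁻¹`
  have hNo : ContDiffOn ℝ ∞ (fun y : EuclideanSpace ℝ (Fin 3) => ‖y‖) {y | y ≠ 0} := fun y hy =>
    (contDiffAt_norm ℝ hy).contDiffWithinAt
  have hWo : ContDiffOn ℝ ∞ (fun y : EuclideanSpace ℝ (Fin 3) => ‖y‖⁻¹) {y | y ≠ 0} :=
    hNo.inv fun y hy => norm_ne_zero_iff.mpr hy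
  obtain ⟨N, hN, hNn⟩ := exists_contDiff_eq_of_contDiffOn hNo hδ
  obtain ⟨W, hW, hWn⟩ := exists_contDiff_eq_of_contDiffOn hWo hδ
  have hdN : ∀ y ∈ {y : EuclideanSpace ℝ (Fin 3) | ‖x‖ / 4 < ‖y‖}, ∀ j, pderiv j N y = y j * W y :=
    fun y hy j => (pderiv_norm_reg hδ hNn hWn hy j).1
  have hdW : ∀ y ∈ {y : EuclideanSpace ℝ (Fin 3) | ‖x‖ / 4 < ‖y‖}, ∀ j, pderiv j W y = -y j * W y ^ 3 :=
    fun y hy j => (pderiv_norm_reg hδ hNn hWn hy j).2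
  set H : Fin 3 → Fin 3 → EuclideanSpace ℝ (Fin 3) → ℝ := fun j m => pderiv j (pderiv m Ψr)
    with hHdef
  set r2 : EuclideanSpace ℝ (Fin 3) → ℝ := fun y => ∑ i, y i ^ 2 with hr2def
  set Lf : EuclideanSpace ℝ (Fin 3) → ℝ := fun y => ∑ l, H l l y with hLdef
  -- the regularised field and its agreement with the true one near `x`
  set br : EuclideanSpace ℝ (Fin 3) → EuclideanSpace ℝ (Fin 3) := fun y => WithLp.toLp 2 fun m =>
    N y * pderiv m Ψr y + (Ψr y - α) * y m * W y with hbr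
  have hbi : ∀ m, (fun y => br y m) = fun y => N y * pderiv m Ψr y + (Ψr y - α) * y m * W y :=
    fun m => by funext y; simp [hbr]
  have hbc : ContDiff ℝ ∞ br := by
    rw [contDiff_euclidean]; intro m; rw [hbi]
    exact (hN.mul (contDiff_pderiv hΨc m)).add (((hΨc.sub contDiff_const).mul (contDiff_coord m)).mul hW)
  have hEqb : (fun y : EuclideanSpace ℝ (Fin 3) => (WithLp.toLp 2 fun m =>
      ‖y‖ * pderiv m Ψ y + (Ψ y - α) * y m * ‖y‖⁻¹ : EuclideanSpace ℝ (Fin 3))) =ᶠ[𝓝 x] br := by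
    filter_upwards [hS.mem_nhds hxS] with y hy
    simp only [hbr, pderiv_eqOn hS hEq _ hy, hEq hy, hNn y (le_of_lt hy), hWn y (le_of_lt hy)]
  -- the partials of the components of `br` vanish at `x`
  have hOb := obata_tracefree_hessian_eq_zero hu hp hns hdiv hhom hΦs hΦ hΦF hΨ hx
  have hp1 : ∀ j, pderiv j Ψ x = pderiv j Ψr x := fun j => pderiv_eqOn hS hEq j hxS
  have hp2 : ∀ j m, pderiv j (pderiv m Ψ) x = pderiv j (pderiv m Ψr) x := fun j m =>
    pderiv_pderiv_eqOn hS hEq j m hxS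
  have hBx : ∀ l m, r2 x * H l m x + pderiv l Ψr x * x m + x l * pderiv m Ψr x -
      r2 x * Lf x / 2 * (if l = m then 1 else 0) + Lf x / 2 * (x l * x m) = 0 := by
    intro l m
    have := hOb.1 l m
    simp only [hp1, hp2] at this
    simp only [hr2def, hLdef, hHdef]
    linarith [this]
  have hlamx : r2 x * Lf x / 2 + Ψr x - α = 0 := by
    have := hα x hx
    simp only [hp2, hEq hxS] at this
    simp only [hr2def, hLdef, hHdef]
    linarith [this]
  have hNx : N x = ‖x‖ := hNn x (le_of_lt hxS)
  have hWx : W x = ‖x‖⁻¹ := hWn x (le_of_lt hxS)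
  have hpb : ∀ m j, pderiv j (fun y => br y m) x = 0 := by
    intro m j
    rw [hbi, pderiv_obataBvec (g := fun m => pderiv m Ψr) (H := H) hΨc hN hW (fun _ => rfl)
      (fun _ _ => rfl) hdN hdW α j m hxS]
    have h := obata_Db_algebra (fun i => x i) (fun m => pderiv m Ψr x) (fun a b => H a b x)
      (fun l m => r2 x * H l m x + pderiv l Ψr x * x m + x l * pderiv m Ψr x -
        r2 x * Lf x / 2 * (if l = m then 1 else 0) + Lf x / 2 * (x l * x m))
      (fun j m => x j * W x * pderiv m Ψr x + N x * H j m x +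
        (pderiv j Ψr x * x m * W x + (Ψr x - α) * ((if j = m then 1 else 0) * W x + x m * (-x j * W x ^ 3))))
      (r2 x) (Lf x) (Ψr x) α (N x) (W x) (by
        rw [hNx]; simp only [hr2def]; exact (EuclideanSpace.real_norm_sq_eq x).symm)
      (by rw [hNx, hWx]; exact mul_inv_cancel₀ hc.ne') (fun l m => rfl) (fun j m => rfl) j m
    simp only at h
    rw [h, hBx j m, hlamx]
    ring
  have hfb : fderiv ℝ br x = 0 :=
    fderiv_eq_zero_of_pderiv_comp_eq_zero ((hbc.differentiable (by simp)) x) hpb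
  refine ⟨((hbc.differentiable (by simp)) x).congr_of_eventuallyEq hEqb, ?_⟩
  rw [hEqb.fderiv_eq, hfb]

/-- **`e^{−Φ/2}` is affine on spheres** (Šverák 2011, §4, (E4)–(E6): "`φ = −2 log(cosh κ −
sinh κ cos θ)`" in a suitable frame).  For the data of Theorem 1 there are a potential `Φ` on
`{x ≠ 0}` with `∇Φ(x) = u(x) − (⟪x, u x⟫/|x|²)x` and `2 + ⟪x, u(x)⟫ = 2e^{Φ(x)}`, and `α > 0`,
`β ∈ ℝ³` with `α² = 1 + |β|²`, such that `e^{−Φ(x)/2} = α + ⟪β, x⟫/|x|` for all `x ≠ 0`.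
[cite: Sverak2011, §4 (E4)–(E6)] -/
theorem exists_affine_conformalFactor (hu : ContDiffOn ℝ ∞ u {x | x ≠ 0})
    (hp : ContDiffOn ℝ ∞ p {x | x ≠ 0})
    (hns : ∀ x, x ≠ 0 → -(Δ u) x + convect u u x + gradient p x = 0)
    (hdiv : ∀ x, x ≠ 0 → VectorCalculus.divergence u x = 0)
    (hhom : ∀ (t : ℝ) (x : EuclideanSpace ℝ (Fin 3)), 0 < t → x ≠ 0 → t • u (t • x) = u x) :
    ∃ Φ : EuclideanSpace ℝ (Fin 3) → ℝ,
      (∀ x : EuclideanSpace ℝ (Fin 3), x ≠ 0 → gradient Φ x = u x - (⟪x, u x⟫ / ‖x‖ ^ 2) • x) ∧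
      (∀ x : EuclideanSpace ℝ (Fin 3), x ≠ 0 → 2 + ⟪x, u x⟫ = 2 * Real.exp (Φ x)) ∧
      ∃ (α : ℝ) (β : EuclideanSpace ℝ (Fin 3)), α ^ 2 = 1 + ‖β‖ ^ 2 ∧ 0 < α ∧
        ∀ x : EuclideanSpace ℝ (Fin 3), x ≠ 0 → Real.exp (-(Φ x) / 2) = α + ⟪β, x⟫ * ‖x‖⁻¹ := by
  have hΩ : IsOpen {y : EuclideanSpace ℝ (Fin 3) | y ≠ 0} := isOpen_compl_singleton
  obtain ⟨Φ, hΦs, hΦ, -, hΦF⟩ := exists_conformal_potential hu hp hns hdiv hhom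
  set Ψ : EuclideanSpace ℝ (Fin 3) → ℝ := fun x => Real.exp (-(Φ x) / 2) with hΨ
  have hOb := fun (x : EuclideanSpace ℝ (Fin 3)) (hx : x ≠ 0) =>
    obata_tracefree_hessian_eq_zero hu hp hns hdiv hhom hΦs hΦ hΦF hΨ hx
  -- Step B: `λ ≡ α`
  obtain ⟨α, hα⟩ : ∃ α : ℝ, ∀ x ∈ {y : EuclideanSpace ℝ (Fin 3) | y ≠ 0},
      (fun y : EuclideanSpace ℝ (Fin 3) =>
        (∑ i, y i ^ 2) * (∑ l, pderiv l (pderiv l Ψ) y) / 2 + Ψ y) x = α :=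
    hΩ.exists_is_const_of_fderiv_eq_zero isPreconnected_compl_zero
      (fun x hx => (obata_lambda_fderiv_eq_zero hu hp hns hdiv hhom hΦs hΦ hΦF hΨ hx).1.differentiableWithinAt)
      (fun x hx => (obata_lambda_fderiv_eq_zero hu hp hns hdiv hhom hΦs hΦ hΦF hΨ hx).2)
  simp only at hα
  -- Step C: `b ≡ β`
  obtain ⟨β, hβ⟩ : ∃ β : EuclideanSpace ℝ (Fin 3), ∀ x ∈ {y : EuclideanSpace ℝ (Fin 3) | y ≠ 0},
      (fun y : EuclideanSpace ℝ (Fin 3) => (WithLp.toLp 2 fun m =>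
        ‖y‖ * pderiv m Ψ y + (Ψ y - α) * y m * ‖y‖⁻¹ : EuclideanSpace ℝ (Fin 3))) x = β :=
    hΩ.exists_is_const_of_fderiv_eq_zero isPreconnected_compl_zero
      (fun x hx => (obata_bvec_fderiv_eq_zero hu hp hns hdiv hhom hΦs hΦ hΦF hΨ hα hx).1.differentiableWithinAt)
      (fun x hx => (obata_bvec_fderiv_eq_zero hu hp hns hdiv hhom hΦs hΦ hΦF hΨ hα hx).2)
  simp only at hβ
  -- Step D: the affine formula
  have haff : ∀ x : EuclideanSpace ℝ (Fin 3), x ≠ 0 → Ψ x = α + ⟪β, x⟫ * ‖x‖⁻¹ := by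
    intro x hx
    have hr : ‖x‖ ≠ 0 := norm_ne_zero_iff.mpr hx
    have hE0 := (hOb x hx).2.1
    have h1 : ⟪β, x⟫ = (Ψ x - α) * ‖x‖ := by
      rw [← hβ x hx]
      simp only [PiLp.inner_apply, RCLike.inner_apply, conj_trivial]
      have : ∑ m, x m * (‖x‖ * pderiv m Ψ x + (Ψ x - α) * x m * ‖x‖⁻¹) =
          ‖x‖ * ∑ m, x m * pderiv m Ψ x + (Ψ x - α) * ‖x‖⁻¹ * ∑ m, x m ^ 2 := by
        rw [Finset.mul_sum, Finset.mul_sum, ← Finset.sum_add_distrib]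
        exact Finset.sum_congr rfl fun m _ => by ring
      rw [this, hE0, mul_zero, zero_add, ← EuclideanSpace.real_norm_sq_eq]
      field_simp
    rw [h1]; field_simp; ring
  -- Step E: `α² = 1 + |β|²` from the relations at the point `e₀`
  set e : EuclideanSpace ℝ (Fin 3) := EuclideanSpace.single 0 1 with he
  have he1 : ‖e‖ = 1 := by simp [he]
  have he0 : e ≠ 0 := norm_ne_zero_iff.mp (by rw [he1]; exact one_ne_zero)
  obtain ⟨-, hE0e, hPDEe, -, -⟩ := hOb e he0
  have hαβ : α ^ 2 = 1 + ‖β‖ ^ 2 := by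
    rw [EuclideanSpace.real_norm_sq_eq]
    refine obata_alpha_algebra (fun i => e i) (fun m => pderiv m Ψ e) (fun m => β m)
      ((∑ i, e i ^ 2)) (∑ l, pderiv l (pderiv l Ψ) e) (∑ l, pderiv l Ψ e ^ 2) (Ψ e) α ‖e‖ ‖e‖⁻¹
      (EuclideanSpace.real_norm_sq_eq e).symm (EuclideanSpace.real_norm_sq_eq e).symm
      (by rw [he1]; norm_num) rfl (fun m => ?_) (by linarith [hα e he0]) hPDEe hE0e
    rw [← hβ e he0]
  -- Step F: `α > 0`
  have hαpos : 0 < α := by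
    by_contra hle
    push Not at hle
    have hβle : ‖β‖ < -α := by nlinarith [norm_nonneg β, hαβ]
    have h1 := haff e he0
    have h2 : ⟪β, e⟫ ≤ ‖β‖ * ‖e‖ := real_inner_le_norm β e
    rw [he1, mul_one] at h2
    have h3 : 0 < Ψ e := Real.exp_pos _
    rw [h1, he1, inv_one, mul_one] at h3
    linarith
  refine ⟨Φ, fun x hx => ?_, hΦF, α, β, hαβ, hαpos, haff⟩
  have h1 := hΦ x hx
  have h2 : innerSL ℝ (u x - (⟪x, u x⟫ / ‖x‖ ^ 2) • x) =
      InnerProductSpace.toDual ℝ _ (u x - (⟪x, u x⟫ / ‖x‖ ^ 2) • x) := rfl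
  rw [h2] at h1
  exact (hasGradientAt_iff_hasFDerivAt.mpr h1).gradient

end Sverak2011

end Literature.Analysis.FluidPDE
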